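import Mathlib.RingTheory.WittVector.Teichmuller
import Mathlib.RingTheory.WittVector.Domain
import Mathlib.FieldTheory.IsAlgClosed.AlgebraicClosure
import Mathlib.FieldTheory.IntermediateField.Adjoin.Algebra
import Literature.AnabelianGeometry.AbsoluteAnabelian.AbsTopIII.KummerFaithful
import HarnessLib

/-!
# [AbsTopIII] Remark 1.5.4 (iv) — DISCHARGE of `Rmk_1_5_4_iv`
# (generalized sub-`p`-adic fields need not be torally Kummer-faithful)

Proof-only companion of `AbsTopIII/KummerFaithful.lean` (abc-iut-L4-t1, p404026; never edited
here).  S. Mochizuki, *Topics in Absolute Anabelian Geometry III*, Rmk. 1.5.4 (iv), kurims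
manuscript p. 34 (lit key `paper:url-5493eb38cbb7`)
[cite: MochizukiAbsTopIII2015, Rmk 1.5.4 (iv) p.34]: "the generalized sub-`p`-adic fields of
[Mzk8], Definition 4.11, are not, in general, torally Kummer-faithful" — the text's reason being
that the quotient field of `W(𝔽̄_p)` contains the (infinitely divisible) group of prime-to-`p`
roots of unity of `𝔽̄_p`.  The tree types the remark as the named fact
`Rmk_1_5_4_iv : ∃ p k, IsGeneralizedSubpadicFor k p ∧ ¬ IsTorallyKummerFaithful k`
(abc-iut node `AbsTopIII:Rmk1.5.4(iv)`).  This file PROVES it (`Rmk_1_5_4_iv_holds`).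

## Proof (kernel witness)

Take `k := Frac W(𝔽̄_p)` itself (any prime `p`; we use `p = 2`).
1. `k` is generalized sub-`p`-adic: it embeds (identically) into the finitely generated
   (indeed trivial) extension `k / k` (`isGeneralizedSubpadicFor_fracWitt`).
2. `k` is not torally Kummer-faithful: for `a ∈ 𝔽̄_p`, `a ≠ 0, 1`, the Teichmüller lift
   `[a] ∈ W(𝔽̄_p)` is a nonzero element, hence a unit `x` of `k`, with `x ≠ 1` (its `0`-th Witt
   coefficient is `a`).  Since `𝔽̄_p` is algebraically closed, for every `N ≥ 1` there is `b` with
   `b^N = a`, and `[·]` is multiplicative, so `x = [b]^N` in `kˣ`.  Thus `x ∈ ⋂_N (kˣ)^N`,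
   `x ≠ 1`, contradicting `DivisibleElementsTrivial kˣ` for the finite extension `k / k`
   (`not_isTorallyKummerFaithful_fracWitt`).
Mathlib-only apart from the statement import; no new definitions, no named facts.
-/

noncomputable section

open scoped Classical

namespace Literature.AnabelianGeometry.AbsoluteAnabelian.AbsTopIII

universe u

open WittVector

variable (p : ℕ) [Fact p.Prime]

/-- A Teichmüller lift `[r]` is nonzero as soon as `r ≠ 0` (its `0`-th Witt component is `r`).
[cite: MochizukiAbsTopIII2015, Rmk 1.5.4 (iv) p.34] -/
theorem teichmuller_ne_zero {R : Type*} [CommRing R] {r : R} (hr : r ≠ 0) :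
    teichmuller p r ≠ 0 := by
  intro h
  apply hr
  have h0 := congrArg (fun w : WittVector p R => w.coeff 0) h
  simpa only [teichmuller_coeff_zero, zero_coeff] using h0

/-- A Teichmüller lift `[r]` equals `1` only if `r = 1`.
[cite: MochizukiAbsTopIII2015, Rmk 1.5.4 (iv) p.34] -/
theorem eq_one_of_teichmuller_eq_one {R : Type*} [CommRing R] {r : R}
    (h : teichmuller p r = 1) : r = 1 := by
  have h0 := congrArg (fun w : WittVector p R => w.coeff 0) h
  simpa only [teichmuller_coeff_zero, one_coeff_zero] using h0

/-- The quotient field of `W(𝔽̄_p)` is generalized sub-`p`-adic (it is a finitely generated —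
indeed trivial — extension of itself). [cite: MochizukiAbsTopIII2015, Rmk 1.5.4 (iv) p.34] -/
theorem isGeneralizedSubpadicFor_fracWitt :
    IsGeneralizedSubpadicFor (FractionRing (WittVector p (AlgebraicClosure (ZMod p)))) p := by
  refine ⟨⟨FractionRing (WittVector p (AlgebraicClosure (ZMod p))), inferInstance, Algebra.id _,
    ?_, ⟨RingHom.id _⟩⟩⟩
  exact IntermediateField.fg_of_noetherian _

/-- In the quotient field `k` of `W(𝔽̄_p)`, the unit group `kˣ` contains an element `≠ 1` that is
an `N`-th power for every `N ≥ 1` (a Teichmüller lift of an element `≠ 0, 1` of the algebraically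
closed residue field), so `DivisibleElementsTrivial kˣ` fails.
[cite: MochizukiAbsTopIII2015, Rmk 1.5.4 (iv) p.34] -/
theorem not_divisibleElementsTrivial_units_fracWitt :
    ¬ DivisibleElementsTrivial (FractionRing (WittVector p (AlgebraicClosure (ZMod p))))ˣ := by
  intro hdiv
  -- the residue field is infinite: pick `a ≠ 0, 1`
  obtain ⟨a, ha⟩ := Infinite.exists_notMem_finset ({0, 1} : Finset (AlgebraicClosure (ZMod p)))
  simp only [Finset.mem_insert, Finset.mem_singleton, not_or] at ha
  obtain ⟨ha0, ha1⟩ := ha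
  -- the Teichmüller lift `[a]`, as a unit of the fraction field
  have hinj := IsFractionRing.injective (WittVector p (AlgebraicClosure (ZMod p)))
    (FractionRing (WittVector p (AlgebraicClosure (ZMod p))))
  have hx0 : algebraMap (WittVector p (AlgebraicClosure (ZMod p)))
      (FractionRing (WittVector p (AlgebraicClosure (ZMod p)))) (teichmuller p a) ≠ 0 := by
    intro h
    exact teichmuller_ne_zero p ha0 (hinj (h.trans (map_zero _).symm))
  set x : (FractionRing (WittVector p (AlgebraicClosure (ZMod p))))ˣ := Units.mk0 _ hx0 with hx
  have hx1 : x ≠ 1 := by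
    intro h1
    apply ha1
    have hval := congrArg Units.val h1
    rw [hx, Units.val_mk0, Units.val_one, ← map_one (algebraMap (WittVector p
      (AlgebraicClosure (ZMod p))) (FractionRing (WittVector p (AlgebraicClosure (ZMod p)))))]
      at hval
    exact eq_one_of_teichmuller_eq_one p (hinj hval)
  refine hx1 (hdiv.eq_one_of_forall_exists_pow x fun n hn => ?_)
  -- `a = b ^ n` in the algebraically closed residue field
  obtain ⟨b, hb⟩ := IsAlgClosed.exists_pow_nat_eq a hn
  have hb0 : b ≠ 0 := by
    rintro rfl
    rw [zero_pow hn.ne'] at hb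
    exact ha0 hb.symm
  have hy0 : algebraMap (WittVector p (AlgebraicClosure (ZMod p)))
      (FractionRing (WittVector p (AlgebraicClosure (ZMod p)))) (teichmuller p b) ≠ 0 := by
    intro h
    exact teichmuller_ne_zero p hb0 (hinj (h.trans (map_zero _).symm))
  refine ⟨Units.mk0 _ hy0, Units.ext ?_⟩
  rw [Units.val_pow_eq_pow_val, Units.val_mk0, hx, Units.val_mk0, ← map_pow, ← map_pow, hb]

/-- The quotient field of `W(𝔽̄_p)` is NOT torally Kummer-faithful (take the trivial finite
extension `k / k` in the definition). [cite: MochizukiAbsTopIII2015, Rmk 1.5.4 (iv) p.34] -/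
theorem not_isTorallyKummerFaithful_fracWitt :
    ¬ IsTorallyKummerFaithful (FractionRing (WittVector p (AlgebraicClosure (ZMod p)))) := by
  intro h
  exact not_divisibleElementsTrivial_units_fracWitt p
    (h.units (FractionRing (WittVector p (AlgebraicClosure (ZMod p)))) (Module.Finite.self _))

/-- DISCHARGE of the named fact `Rmk_1_5_4_iv` ([AbsTopIII] Rmk. 1.5.4 (iv) p. 34: "the
generalized sub-`p`-adic fields … are not, in general, torally Kummer-faithful"), abc-iut node
`AbsTopIII:Rmk1.5.4(iv)`: witness `p = 2`, `k = Frac W(𝔽̄_2)`.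
[cite: MochizukiAbsTopIII2015, Rmk 1.5.4 (iv) p.34] -/
theorem Rmk_1_5_4_iv_holds : Rmk_1_5_4_iv :=
  ⟨2, ⟨Nat.prime_two⟩, FractionRing (WittVector 2 (AlgebraicClosure (ZMod 2))), inferInstance,
    @isGeneralizedSubpadicFor_fracWitt 2 ⟨Nat.prime_two⟩,
    @not_isTorallyKummerFaithful_fracWitt 2 ⟨Nat.prime_two⟩⟩

end Literature.AnabelianGeometry.AbsoluteAnabelian.AbsTopIII
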